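import Summits.QuantumFields.BalabanUV.T4Continuum.Support.NE9Lemma1SpeciesEndAdditive
import Summits.QuantumFields.BalabanUV.T4Continuum.Support.NE9Lemma1CurveSpeciesAdditive

/-!
# NE9Lemma1SpeciesEndAdditiveCur — the NE9 END (`…_compProj` face) at the ASSEMBLED species channel 𝒯 = 𝒯_(a) + 𝒯_(b) of
# [I] §§3–4 (row owner t4-ne9-p1-g25, `NE9Lemma1SpeciesEnd` p215007) WITH BOTH S3 ADDITIVITY BINDERS DISCHARGED BY NAME —
# species (a) (Bałaban's slice curves) by crew row (w19) `NE9Lemma1CurveSpeciesAdditive.pieceAdditiveOn_cur` (author leaf-08-g4;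
# p215330), species (b) (the point-localized terms of §4) by crew row (w23) `NE9Lemma1KernelSpeciesAdditive.pieceAdditiveOn_ker`
# (p214868) — cell `pub-balaban`, T4-DAG §2 node U3 / §6 NE9; rung (B)+1 on a FIXED finite T⁴; NE9 formalisation swarm, unit
# `b2b-balaban-t4-ne9-formalise-leaf-01` gen 7, «END-SPECIES-S3» §2 (journal CLAIM l.11187, §1 = `NE9Lemma1SpeciesEndAdditive`
# p215266); nothing of any import is modified

HONEST FRAMING (T4-DAG PAGE 1).  Rung (B)+1 = existence and uniqueness of the ε → 0 limit of gauge-invariant observables on a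
FIXED finite torus T⁴ — NOT infinite volume, NOT a mass gap, NOT the Clay problem.  NE9 (`T4OutputRate.NE9` ∧ `FadingMemory`) is
a cell NEW ESTIMATE, NOT PRINTED and NOT discharged here («NE9 ⇐ the named binders»); spine 0/9.  HONEST DEPENDENCY (cell line,
verbatim): continuum YM on T⁴ ⇐ BetaPertH ∧ nine spine estimates (0/9 proved); BetaPertH ⇐ (D1) ∧ (D4) ∧ CAP+tail; G-an2-4 gates
asym, D1 and NE2/3/4.  `FlowStep.BetaPertH`, (B), (B^μ) do not occur.  [I] = [Balaban1987RG1] (CMP **109**), [II] =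
[Balaban1988RG2Cluster] (CMP **116**) are quoted for TYPES only (ABSOLUTE RULE: nothing printed in the audited series is asserted).

WHAT THIS FILE IS.  §1 of «END-SPECIES-S3» (`NE9Lemma1SpeciesEndAdditive`, p215266) removed the species-(b) additivity binder
`hAb` from the displayed list of the owner's END face at the full species channel; the species-(a) binder
`hAa : PieceAdditiveOn (analyticClass D.R) D.toC` stayed displayed because its discharger — crew row (w19), leaf-08-g4's
`pieceAdditiveOn_cur` — was verified but not yet committed.  It is in the tree now (p215330, the author's bytes filed by courier),
so THIS FILE substitutes it as well:
**`termSize_ne9_and_fadingMemory_species_compProj_add`** — p215007's face TOKEN FOR TOKEN with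
`hAa ↦ pieceAdditiveOn_cur D _ hD.r_pos hD.ϱ_gt hcurA hcurC` (`0 < κ₁` from `CurData.Admissible.κ₁_ge`, `0 < r_k` from `.r_pos`,
`1 < ϱ` from `.ϱ_gt`) and `hAb ↦ pieceAdditiveOn_ker K _ hK.r_pos hkerA hkerC` (via §1).  Displayed IN THEIR PLACE, in the
dischargers' exact shapes: for species (a) the SLICE-CURVE REGULARITY binders `hcurA` (every slice curve analytic on its disc
`|σ′| < ϱ` and mapping it into the analyticity ball of its source — TYPE [I] Lemma 4 (3.53) p. 280, the `Admissible.cur_an`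
clause asked everywhere) and `hcurC` (the curve family jointly continuous in `(t, s, σ, σ′)` on the unit slice circle — TYPE [II]
(1.21)/(1.23) p. 7); for species (b) the SUMMAND REGULARITY binders `hkerA` (subtractive in the old term on the analytic class)
and `hkerC` (jointly continuous in the contour variables) — TYPE [I] (4.21) p. 285 / (4.22) p. 286.  EVERYTHING ELSE VERBATIM;
conclusion LITERALLY the face's, `ω′ = ω + 8·lipbar·B·((1 + c)·(cQ_(a) + cQ_(b)))`.
So after this file the END's displayed list for the FULL species channel of [I] §§3–4 carries NO abstract S-binder at all:
O1-type data (`CurData` curves, `KerData` bilocal summands, carriers, `P`, `Ψ`, `act`, `ρ`, …), `CurData.Admissible` (Lemma 4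
(3.53) TYPE + gain + G1), `KerData.Admissible` ((K) p. 286 TYPE, (G), (S), G1), the two level counts (at κ and at κ − w), the
curve regularity `hcurA`/`hcurC`, the summand regularity `hkerA`/`hkerC`, `MF ⊆ analyticClass`, and the face's own
A1/A2/A3/RO-type binders and scalars.  DISGUISE TEST: unchanged from the face (skeleton §5 (g2)) — one END-level composition BY
NAME; no two-history content is added or removed; not NE9.

References (TYPES only): [Balaban1987RG1] T. Bałaban, CMP **109** (1987) 249–301, (3.34) p. 277, Lemma 4 (3.53)–(3.54) p. 280,
(4.21) p. 285, (4.22) p. 286; [Balaban1988RG2Cluster] T. Bałaban, CMP **116** (1988) 1–22, (1.21)–(1.29) pp. 7–8, (1.33)–(1.36)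
p. 9.  Summits-side NEW work (LEAN PLACEMENT RULE); imports §1 `NE9Lemma1SpeciesEndAdditive` (p215266; it re-exports the owner's
`NE9Lemma1SpeciesEnd` p215007 and (w23) p214868) and (w19) `NE9Lemma1CurveSpeciesAdditive` (p215330) ONLY; modifies nothing;
0 `def`, 0 sorry.  Value = bookkeeping: the last two abstract S-binders of the END for the FULL species channel replaced by their
kernel dischargers' displayed inputs, NOT summit progress.
-/

noncomputable section

namespace Summit.QuantumFields.BalabanUV.T4Continuum.NE9Lemma1SpeciesEndAdditiveCur

open scoped BigOperators
open Metric Set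
open Literature.Probability.LatticeModels
open Literature.MathematicalPhysics.QuantumFieldTheory.Balaban1983to89
open Literature.MathematicalPhysics.QuantumFieldTheory.Balaban1983to89.T4OutputRate
open Literature.MathematicalPhysics.QuantumFieldTheory.Balaban1983to89.T4HistoryLipschitzRecursion
open Literature.MathematicalPhysics.QuantumFieldTheory.Balaban1983to89.T4HistoryLipschitzOuter
open Literature.MathematicalPhysics.QuantumFieldTheory.Balaban1983to89.T4HistoryLipschitzActivity
open Literature.MathematicalPhysics.QuantumFieldTheory.Balaban1983to89.T4HistoryLipschitzActivity (ClusterGeom)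
open Literature.MathematicalPhysics.QuantumFieldTheory.Balaban1983to89.T4HistoryLipschitzSegment
open Summit.QuantumFields.BalabanUV.T4Continuum.NE9Lemma1Counting
open Summit.QuantumFields.BalabanUV.T4Continuum.NE9Lemma1Gain
open Summit.QuantumFields.BalabanUV.T4Continuum.NE9Lemma1PieceClass
open Summit.QuantumFields.BalabanUV.T4Continuum.NE9Lemma1RemainderSpecies
open Summit.QuantumFields.BalabanUV.T4Continuum.NE9Lemma1CurveSpecies
open Summit.QuantumFields.BalabanUV.T4Continuum.NE9Lemma1CurveSpeciesAdditive (pieceAdditiveOn_cur)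
open Summit.QuantumFields.BalabanUV.T4Continuum.NE9Lemma1KernelSpecies
open Summit.QuantumFields.BalabanUV.T4Continuum.NE9Lemma1SpeciesEndAdditive
open Summit.QuantumFields.BalabanUV.T4Continuum.NE9ComplexEncoding (doubleCarriers)
open Summit.QuantumFields.BalabanUV.T4Continuum.NE9MarginalProjection
open Summit.QuantumFields.BalabanUV.T4Continuum.NE9MarginalProjectionEnd

variable {C₀ : Carriers} {E : Type} [NormedAddCommGroup E] [NormedSpace ℂ E]
  {ι α β γ δ α' β' γ' δ' Pt : Type} [DecidableEq δ] [DecidableEq δ']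

/-- **THE NE9 END (`…_compProj` face) AT THE ASSEMBLED SPECIES CHANNEL 𝒯 = 𝒯_(a) + 𝒯_(b) WITH BOTH S3 BINDERS DISCHARGED**
(«END-SPECIES-S3» §2).  The owner's `termSize_ne9_and_fadingMemory_species_compProj` (p215007) token for token, except that
BOTH displayed piece-additivity binders are PRODUCED inside: species (a)'s `hAa : PieceAdditiveOn (analyticClass D.R) D.toC` by
crew row (w19)'s `NE9Lemma1CurveSpeciesAdditive.pieceAdditiveOn_cur` (leaf-08-g4) from `CurData.Admissible` (`1 ≤ κ₁`, `0 < r_k`,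
`1 < ϱ`) and the SLICE-CURVE REGULARITY binders displayed here in its place — **`hcurA`** (every slice curve analytic on its disc
`|σ′| < ϱ`, mapping it into the analyticity ball of its source; TYPE [I] Lemma 4 (3.53) p. 280) and **`hcurC`** (the curve family
jointly continuous in `(t, s, σ, σ′)` on the unit slice circle; TYPE [II] (1.21)/(1.23) p. 7); species (b)'s
`hAb : PieceAdditiveOn (analyticClass K.R) K.toC` by crew row (w23)'s `NE9Lemma1KernelSpeciesAdditive.pieceAdditiveOn_ker` (via
§1 `…_species_compProj_addKer`) from `KerData.Admissible` and the SUMMAND-REGULARITY binders **`hkerA`** / **`hkerC`** (TYPE [I]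
(4.21) p. 285 / (4.22) p. 286).  The identification binders `hκ₁`/`hR`/`hdY`, the two level counts, `MF ⊆ analyticClass D.R` and the
face's own binders are VERBATIM; conclusion LITERALLY the face's with `ω′ = ω + 8·lipbar·B·((1 + c)·(cQ_(a) + cQ_(b)))`.
[cite: Balaban1987RG1, (3.34) p.277, (3.53)-(3.54) p.280, (4.21) p.285, (4.22) p.286; Balaban1988RG2Cluster, (1.21)-(1.29) pp.7-8, (1.33)-(1.36) p.9] -/
theorem termSize_ne9_and_fadingMemory_species_compProj_add (G : ClusterGeom (doubleCarriers C₀)) {Pot : Type*}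
    [NormedAddCommGroup Pot] [NormedSpace ℂ Pot] {D : CurData C₀ E ι α β γ δ} {K : KerData C₀ E ι α' β' γ' δ' Pt}
    {ℓg ℓk gain : ℕ → ℕ → ℝ} {cdir cK δ₀ δ₁ w w0 c0 c1 d0 O1 cQa cQb : ℝ}
    {Ef : Functional (doubleCarriers C₀) E} {W : Set (ℕ → ℝ)}
    {Adm MF : Set (E → (doubleCarriers C₀).Dom → ℝ)}
    {P : (E → (doubleCarriers C₀).Dom → ℝ) → (E → (doubleCarriers C₀).Dom → ℝ)}
    {Ψ : ℕ → ℝ → (ι → ℝ) → E → (doubleCarriers C₀).Dom → ℝ} {act : ℕ → ℝ → E → Pot → G.P → ℂ} {𝒜 : ℕ → Set Pot}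
    {n : ℕ → ℝ → E → G.P → ℝ} {lip clip : ℕ → ℝ} {a d : G.P → ℝ} {δv : (doubleCarriers C₀).Dom → ℝ}
    {κ B lipbar clipbar qTbar ω c : ℝ} {qT p₀ N : ℕ → ℝ}
    -- species (a): the curve datum and its binders; (w19)'s displayed inputs IN PLACE OF `hAa`
    (hD : D.Admissible ℓg cdir d0) (hℓg : ∀ k j, 0 ≤ ℓg k j)
    (hLa : LevelCountsG D.toC.frame κ D.κ₁ O1 cQa (fun k j => ℓg k j ^ 5) (agePow ω))
    (hcurA : ∀ k s y a b x t s' σ', DifferentiableOn ℂ (D.cur k s y a b x t s' σ') (ball 0 (D.ϱ k s y a b x)) ∧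
      MapsTo (D.cur k s y a b x t s' σ') (ball 0 (D.ϱ k s y a b x)) (ball 0 (D.R x.1)))
    (hcurC : ∀ k s y a b x, ContinuousOn
      (fun q : (ℂ × (δ → ℝ) × (δ → ℂ)) × ℂ => D.cur k s y a b x q.1.1 q.1.2.1 q.1.2.2 q.2) (univ ×ˢ sphere (0:ℂ) 1))
    -- species (b): the kernel datum and its binders, on the SAME κ₁ / radii / output geometry; (w23)'s inputs IN PLACE OF `hAb`
    (hK : K.Admissible ℓk gain cK δ₀ δ₁ w w0 c0 c1 d0) (hκ₁ : K.κ₁ = D.κ₁) (hR : K.R = D.R)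
    (hdY : K.toC.frame.dY = D.toC.frame.dY)
    (hLb : LevelCountsG K.toC.frame (κ - w) K.κ₁ O1 cQb gain (agePow ω))
    (hkerA : ∀ (k : ℕ) (s : ℕ → ℝ) (y : ι) (a : α') (b : β') (x : (doubleCarriers C₀).Dom) (t : ℂ) (s' : δ' → ℝ)
      (σ' : δ' → ℂ), ∀ p ∈ K.pts k y a, ∀ q ∈ K.pts k y a, ∀ F₁ F₂ : E → ℂ,
        DifferentiableOn ℂ F₁ (ball 0 (K.R x.1)) → DifferentiableOn ℂ F₂ (ball 0 (K.R x.1)) →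
          K.ker k s y a b x t s' σ' p q (F₁ - F₂) = K.ker k s y a b x t s' σ' p q F₁ - K.ker k s y a b x t s' σ' p q F₂)
    (hkerC : ∀ (k : ℕ) (s : ℕ → ℝ) (y : ι) (a : α') (b : β') (x : (doubleCarriers C₀).Dom),
      ∀ p ∈ K.pts k y a, ∀ q ∈ K.pts k y a, ∀ F : E → ℂ, DifferentiableOn ℂ F (ball 0 (K.R x.1)) →
        Continuous fun w : ℂ × (δ' → ℝ) × (δ' → ℂ) => K.ker k s y a b x w.1 w.2.1 w.2.2 p q F)
    (hO1 : 0 ≤ O1) (hcQa : 0 ≤ cQa) (hcQb : 0 ≤ cQb) (hMF : MF ⊆ analyticClass D.R)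
    -- the face's binders, verbatim, at 𝒯 := cpieceChannel D.toC + cpieceChannel K.toC
    (ρ : ℕ → (ι → ℝ) → Pot) (U₀ : E) (explZ : ℕ → E → (doubleCarriers C₀).Dom → ℝ) (h0 : ScaleZeroFree Ef W)
    (hAdm : AdmissibleTerms Ef W Adm) (hres : AdmRestrict Adm)
    (hPadd : ProjAdditive Adm P) (hPcomm : ProjScaleComm Adm P) (hPinto : ProjInto Adm MF P) (hPsize : ProjSize Adm P κ c)
    (hc : 0 ≤ c)
    (hfac : Factorises Ef W (compProj (cpieceChannel D.toC + cpieceChannel K.toC) P) Ψ) (hclip0 : ∀ k, 0 ≤ clip k)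
    (hCup : ∀ g ∈ W, ∀ g' ∈ W, ∀ (k : ℕ) (U : E) (X : (doubleCarriers C₀).Dom), (doubleCarriers C₀).scale X = k + 1 →
      ∀ Q ∈ 𝒜 k, ∀ γ' ∈ G.vol X,
      ‖act k (g k) U Q γ'‖ ≤ n k (g' k) U γ' ∧
        ‖act k (g k) U Q γ' - act k (g' k) U Q γ'‖ ≤ clip k * |g k - g' k| * n k (g' k) U γ')
    (hqT0 : ∀ k, 0 ≤ qT k)
    (hTcup : ∀ g ∈ W, ∀ g' ∈ W, ∀ (k : ℕ) (y : ι),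
      |compProj (cpieceChannel D.toC + cpieceChannel K.toC) P k g (Ef g) y -
        compProj (cpieceChannel D.toC + cpieceChannel K.toC) P k g' (Ef g) y| ≤
        weightOf D.toC.frame D.κ₁ d0 O1 (D.Kp cdir + K.Kp cK w0 c0 c1) k y * (qT k * |g k - g' k|))
    (hreprV : ∀ (k : ℕ) (s : ℝ) (Q : ι → ℝ) (U : E) (X : (doubleCarriers C₀).Dom),
      Ψ k s Q U X = (G.newTerm act k s U X (ρ k Q)).re - (G.newTerm act k s U₀ X (ρ k Q)).re + explZ k U X)
    (hclipb : ∀ k, clip k ≤ clipbar) (hqTb : ∀ k, qT k ≤ qTbar)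
    (hKP : TwoPointKP G W act 𝒜 n lip a d) (hdec : G.DecayExtract δv d) (hpin : G.PinBudget a δv (fun _ => B) κ)
    (hρ : ∀ (k : ℕ) (Q Q' : ι → ℝ) (M : ℝ),
      (∀ y, |Q y - Q' y| ≤ weightOf D.toC.frame D.κ₁ d0 O1 (D.Kp cdir + K.Kp cK w0 c0 c1) k y * M) →
        ‖ρ k Q - ρ k Q'‖ ≤ M)
    (hexplZ : ∀ (k : ℕ) (U : E) (X : (doubleCarriers C₀).Dom), (doubleCarriers C₀).scale X = k + 1 →
      |explZ k U X| ≤ Real.exp (-(κ * (doubleCarriers C₀).d X)) * p₀ k)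
    (hbase : ∀ g ∈ W, ∀ (U : E) (X : (doubleCarriers C₀).Dom), (doubleCarriers C₀).scale X = 0 →
      |Ef g U X| ≤ Real.exp (-(κ * (doubleCarriers C₀).d X)) * N 0)
    (hNsucc : ∀ j, p₀ j + 2 * B ≤ N (j + 1)) (hNnn : ∀ j, 0 ≤ N j)
    (hbox : ∀ (k : ℕ) (Q : ι → ℝ), (∀ y, |Q y| ≤ weightOf D.toC.frame D.κ₁ d0 O1 (D.Kp cdir + K.Kp cK w0 c0 c1) k y *
      sizeRadius (fun k j => (1 + c) * (tauOfG cQa (agePow ω) + tauOfG cQb (agePow ω)) k j) N k) → ρ k Q ∈ 𝒜 k)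
    (hB : 0 ≤ B) (hlipb : ∀ k, lip k ≤ lipbar) (hω : 0 ≤ ω)
    (hpos : 0 < ω + 8 * lipbar * B * ((1 + c) * (cQa + cQb))) :
    TermSize Ef W κ N ∧
      NE9 Ef W κ (prodModuli (8 * clipbar * B + 8 * lipbar * B * qTbar)
        fun _ => ω + 8 * lipbar * B * ((1 + c) * (cQa + cQb))) ∧
        FadingMemory ((8 * clipbar * B + 8 * lipbar * B * qTbar) / (ω + 8 * lipbar * B * ((1 + c) * (cQa + cQb))))
          (ω + 8 * lipbar * B * ((1 + c) * (cQa + cQb)))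
          (prodModuli (8 * clipbar * B + 8 * lipbar * B * qTbar)
            fun _ => ω + 8 * lipbar * B * ((1 + c) * (cQa + cQb))) :=
  -- species (a)'s S3 binder PRODUCED by (w19) from `CurData.Admissible` (κ₁ ≥ 1, r_k > 0, ϱ > 1) and `hcurA`/`hcurC`
  have hAa : PieceAdditiveOn (analyticClass D.R) D.toC :=
    pieceAdditiveOn_cur D (lt_of_lt_of_le one_pos hD.κ₁_ge) hD.r_pos hD.ϱ_gt hcurA hcurC
  termSize_ne9_and_fadingMemory_species_compProj_addKer G hD hℓg hLa hAa hK hκ₁ hR hdY hLb hkerA hkerC hO1 hcQa hcQb hMF ρ U₀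
    explZ h0 hAdm hres hPadd hPcomm hPinto hPsize hc hfac hclip0 hCup hqT0 hTcup hreprV hclipb hqTb hKP hdec hpin hρ hexplZ hbase
    hNsucc hNnn hbox hB hlipb hω hpos

end Summit.QuantumFields.BalabanUV.T4Continuum.NE9Lemma1SpeciesEndAdditiveCur

end
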